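import Mathlib
import Summits.ValiantsHypothesis.ValiantsHypothesis.Theorems.NewtonUnitEquationsDissociatedUniformTotalsLawChains
import Summits.ValiantsHypothesis.ValiantsHypothesis.Theorems.NewtonUnitEquationsDissociatedUniformTotalsLawUnionCoSmall
import HarnessLib

/-!
# Crux `NewtonUnitEquations.DissociatedUniform` (stmt-ValiantsHypothesis-5905): counting chain points — the union bound in the DENSE-POSITIONS regime

Companion of `…TotalsLawChains` (chain localisation: a strict top of the fibre union `U_s(Z)` in a direction along which both
label sequences are cyclically unimodal is a forward-chain point `a(m_α + i) + b(m_β + j)`, `i + j` = forward gap, or a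
backward-chain point) and of `…TotalsLawConvexUnionSharpness` (the constant `2` of the pointwise rung `ConvexUnionVertBound` is
false; census: `4q − 2|W|` attained).  Here the localisation is turned into COUNTS:

* `exists_modePair_chain_of_mem_extremePoints` (both curves convexly ordered, nothing else): every hull vertex of `U_s(Z)` is a
  chain point of a MODE PAIR `(m_α, m_β)` whose point `a m_α + b m_β` is a hull vertex of `A + B` (expose the vertex at a chart time
  generic for the pair sumset, `exists_generic_isStrictTop`; the mode pair is then the strict top of `A + B`).
* `card_modePairs_le`: for injective curves the mode LABEL pairs number `≤ 2q` (unique decomposition of a sumset vertex,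
  `eq_of_add_eq_of_mem_extremePoints`, and the planar Minkowski bound).
* **`unionVert_le_of_dense`**: if every window of `L + 1` consecutive positions meets `Z` (all gaps `≤ L`), then
  `#vert conv U_s(Z) ≤ 4(L + 1)·q` for every class `s` (each mode pair carries `≤ 2(L + 1)` chain points), and
  **`unionTotal_le_of_dense`**: `unionTotal a b Z ≤ 4(L + 1)·q²` — both curves convexly ordered and injective.
  This is the MANY-SHORT-GAPS regime, complementary to the FEW-RUNS bound `(2 + #bdry Z)·q` of `…TotalsLawUnimodal` and to the
  co-small bound of `…TotalsLawUnionCoSmall`; the uniform rung (`ConvexUnionVertBound C`, `C ∈ [3, 4]` by the census) needs the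
  kinetic nesting of the chains along a rotation (memo `Cruxes/DissociatedUniform/NOTES-t1g6.md` §3) and is NOT proved here.
Honest label: a regime theorem on the convexly ordered stratum; `UnionTotalsLaw`, `TotalsLawThree` remain OPEN; nothing here
bears on VP ≠ VNP.
[folklore]
-/

set_option linter.dupNamespace false -- `ValiantsHypothesis.ValiantsHypothesis` (summit = problem) in every name

open scoped BigOperators Pointwise

namespace Summit.ValiantsHypothesis.ValiantsHypothesis.Theorems.NewtonUnitEquationsDissociatedUniform

namespace TotalsLaw

open Literature.Computability.AlgebraicComplexity.KPTT.PlanarMinkowski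

section ChainCount

variable {q : ℕ} [NeZero q]

omit [NeZero q] in
/-- A position set meeting every window of `L + 1` consecutive positions FORWARD also meets every such window BACKWARD.
[folklore] -/
theorem dense_backward (Z : Finset (ZMod q)) {L : ℕ} (hZ : ∀ z : ZMod q, ∃ n : ℕ, n ≤ L ∧ z + (n : ZMod q) ∈ Z)
    (z : ZMod q) : ∃ n : ℕ, n ≤ L ∧ z - (n : ZMod q) ∈ Z := by
  obtain ⟨n, hn, hmem⟩ := hZ (z - (L : ZMod q))
  refine ⟨L - n, Nat.sub_le L n, ?_⟩
  rw [Nat.cast_sub hn]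
  convert hmem using 1
  ring

variable (a b : ZMod q → (Fin 2 → ℝ))

/-- The label pairs of the hull vertices of `A + B` are at most `2q` when both curves are injective (a hull vertex of a sumset
has a unique decomposition, `eq_of_add_eq_of_mem_extremePoints`; planar Minkowski bound `#vert(A + B) ≤ 2q`). [folklore] -/
theorem card_modePairs_le (hai : Function.Injective a) (hbi : Function.Injective b)
    (MP : Finset (ZMod q × ZMod q))
    (hMP : ∀ xy ∈ MP, a xy.1 + b xy.2 ∈ (convexHull ℝ (Set.range a + Set.range b)).extremePoints ℝ) :
    MP.card ≤ 2 * q := by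
  classical
  set V := (convexHull ℝ (Set.range a + Set.range b)).extremePoints ℝ with hV
  have hVfin : V.Finite := ((Set.finite_range a).add (Set.finite_range b)).subset extremePoints_convexHull_subset
  have hcoe : ((Finset.univ.image a + Finset.univ.image b : Finset (Fin 2 → ℝ)) : Set (Fin 2 → ℝ)) =
      Set.range a + Set.range b := by
    rw [Finset.coe_add, Finset.coe_image, Finset.coe_image, Finset.coe_univ, Set.image_univ, Set.image_univ]
  have hinj : Set.InjOn (fun xy : ZMod q × ZMod q => a xy.1 + b xy.2) MP := by
    intro xy hxy xy' hxy' heq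
    have hv : a xy'.1 + b xy'.2 ∈ (convexHull ℝ ((Finset.univ.image a + Finset.univ.image b :
        Finset (Fin 2 → ℝ)) : Set (Fin 2 → ℝ))).extremePoints ℝ := by
      rw [hcoe]; exact hMP xy' hxy'
    have h := eq_of_add_eq_of_mem_extremePoints hv (Finset.mem_image_of_mem a (Finset.mem_univ xy.1))
      (Finset.mem_image_of_mem a (Finset.mem_univ xy'.1)) (Finset.mem_image_of_mem b (Finset.mem_univ xy.2))
      (Finset.mem_image_of_mem b (Finset.mem_univ xy'.2)) heq rfl
    exact Prod.ext (hai h.1) (hbi h.2)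
  calc MP.card ≤ hVfin.toFinset.card :=
        Finset.card_le_card_of_injOn _ (by intro xy hxy; simpa [Set.Finite.mem_toFinset] using hMP xy hxy) hinj
    _ = V.ncard := (Set.ncard_eq_toFinset_card V hVfin).symm
    _ ≤ 2 * q := ncard_extremePoints_pairSum_le a b

/-- The mode pair of a chart direction generic for the pair sumset is a hull vertex of `A + B`. [folklore] -/
theorem modePair_mem_extremePoints {w : Fin 2 → ℝ} {nα nβ : ZMod q} {dα dβ : ℕ}
    (hα : CycUnimodalAt (fun x => w ⬝ᵥ a x) nα dα) (hβ : CycUnimodalAt (fun y => w ⬝ᵥ b y) nβ dβ)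
    (hgen : ∀ u ∈ pairFin a b, ∀ v ∈ pairFin a b, u ≠ v → w ⬝ᵥ u ≠ w ⬝ᵥ v) :
    a (nα + (dα : ZMod q)) + b (nβ + (dβ : ZMod q)) ∈ (convexHull ℝ (Set.range a + Set.range b)).extremePoints ℝ := by
  classical
  set v := a (nα + (dα : ZMod q)) + b (nβ + (dβ : ZMod q)) with hv
  have hvS : v ∈ pairFin a b := Finset.mem_image.2 ⟨(nα + (dα : ZMod q), nβ + (dβ : ZMod q)), Finset.mem_univ _, rfl⟩
  have hst : IsStrictTop w (pairFin a b) v := by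
    refine ⟨hvS, fun y hy hne => lt_of_le_of_ne ?_ (hgen y hy v hvS hne)⟩
    obtain ⟨xy, -, rfl⟩ := Finset.mem_image.1 hy
    rw [hv, dotProduct_add, dotProduct_add]
    exact add_le_add (hα.le_mode xy.1) (hβ.le_mode xy.2)
  rw [← coe_pairFin a b]
  exact hst.mem_extremePoints

/-- **Every hull vertex of a fibre union is a chain point of a mode pair** (both curves convexly ordered; no injectivity,
no general position): there are labels `m_α, m_β` whose point `a m_α + b m_β` is a hull vertex of `A + B` (the mode pair of a
direction exposing the vertex) such that the vertex is a forward-chain point `a(m_α + i) + b(m_β + j)`, `i + j` = the forward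
gap from `m_α + m_β` to the present fibres, or a backward-chain point. [folklore] -/
theorem exists_modePair_chain_of_mem_extremePoints (ha : ConvexlyOrdered a) (hb : ConvexlyOrdered b)
    (Z : Finset (ZMod q)) (s : ZMod q) {p : Fin 2 → ℝ}
    (hp : p ∈ (convexHull ℝ (unionPts a b (Z : Set (ZMod q)) s)).extremePoints ℝ) :
    ∃ mα mβ : ZMod q, a mα + b mβ ∈ (convexHull ℝ (Set.range a + Set.range b)).extremePoints ℝ ∧
      ((∃ i j : ℕ, p = a (mα + (i : ZMod q)) + b (mβ + (j : ZMod q)) ∧ s - (mα + mβ + ((i + j : ℕ) : ZMod q)) ∈ Z ∧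
          ∀ n : ℕ, n < i + j → s - (mα + mβ + (n : ZMod q)) ∉ Z) ∨
        (∃ i j : ℕ, p = a (mα - (i : ZMod q)) + b (mβ - (j : ZMod q)) ∧ s - (mα + mβ - ((i + j : ℕ) : ZMod q)) ∈ Z ∧
          ∀ n : ℕ, n < i + j → s - (mα + mβ - (n : ZMod q)) ∉ Z)) := by
  classical
  rw [← coe_unionFin a b (Z : Set (ZMod q)) s] at hp
  obtain ⟨σ, t, -, hgen, -, htop⟩ :=
    exists_generic_isStrictTop (unionFin a b (Z : Set (ZMod q)) s) (pairFin a b) (pairFin a b) hp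
  obtain ⟨nα, dα, hα⟩ := ha ![σ, t]
  obtain ⟨nβ, dβ, hβ⟩ := hb ![σ, t]
  exact ⟨nα + (dα : ZMod q), nβ + (dβ : ZMod q), modePair_mem_extremePoints a b hα hβ hgen,
    exists_chain_of_isStrictTop a b hα hβ Z s htop⟩

/-- **The union bound in the DENSE-POSITIONS regime** (both curves convexly ordered and injective): if every window of
`L + 1` consecutive positions meets `Z`, then `#vert conv U_s(Z) ≤ 4(L + 1)·q` for every class `s`.
Proof: a hull vertex is exposed at a chart time generic for `A + B`; by chain localisation it is one of the `≤ 2(L + 1)` chain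
points of the mode pair `(m_α, m_β)` (both gaps are `≤ L`), and the mode pairs over all directions are the `≤ 2q` hull vertices of
`A + B`.  (Complements the FEW-RUNS bound `(2 + #bdry Z)·q` of `…TotalsLawUnimodal`: here MANY short gaps are allowed.)
[folklore] -/
theorem unionVert_le_of_dense (ha : ConvexlyOrdered a) (hb : ConvexlyOrdered b) (hai : Function.Injective a)
    (hbi : Function.Injective b) (Z : Finset (ZMod q)) {L : ℕ}
    (hZ : ∀ z : ZMod q, ∃ n : ℕ, n ≤ L ∧ z + (n : ZMod q) ∈ Z) (s : ZMod q) :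
    unionVert a b (Z : Set (ZMod q)) s ≤ 4 * (L + 1) * q := by
  classical
  -- the two gap functions
  have hexF : ∀ m : ZMod q, ∃ n : ℕ, s - (m + (n : ZMod q)) ∈ Z := fun m => by
    obtain ⟨n, -, hn⟩ := dense_backward Z hZ (s - m)
    exact ⟨n, by rw [show s - (m + (n : ZMod q)) = s - m - n by ring]; exact hn⟩
  have hexB : ∀ m : ZMod q, ∃ n : ℕ, s - (m - (n : ZMod q)) ∈ Z := fun m => by
    obtain ⟨n, -, hn⟩ := hZ (s - m)
    exact ⟨n, by rw [show s - (m - (n : ZMod q)) = s - m + n by ring]; exact hn⟩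
  let gF : ZMod q → ℕ := fun m => Nat.find (hexF m)
  let gB : ZMod q → ℕ := fun m => Nat.find (hexB m)
  have gF_le : ∀ m, gF m ≤ L := fun m => by
    obtain ⟨n, hn, hmem⟩ := dense_backward Z hZ (s - m)
    exact (Nat.find_le (by rw [show s - (m + (n : ZMod q)) = s - m - n by ring]; exact hmem)).trans hn
  have gB_le : ∀ m, gB m ≤ L := fun m => by
    obtain ⟨n, hn, hmem⟩ := hZ (s - m)
    exact (Nat.find_le (by rw [show s - (m - (n : ZMod q)) = s - m + n by ring]; exact hmem)).trans hn
  -- mode pairs and candidates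
  set V := (convexHull ℝ (Set.range a + Set.range b)).extremePoints ℝ with hV
  set MP : Finset (ZMod q × ZMod q) := Finset.univ.filter fun xy => a xy.1 + b xy.2 ∈ V with hMPdef
  have hMP : ∀ xy ∈ MP, a xy.1 + b xy.2 ∈ V := fun xy hxy => (Finset.mem_filter.1 hxy).2
  have hcardMP : MP.card ≤ 2 * q := card_modePairs_le a b hai hbi MP hMP
  let f : (ZMod q × ZMod q) × (Bool × ℕ) → (Fin 2 → ℝ) := fun t =>
    if t.2.1 then a (t.1.1 + (t.2.2 : ZMod q)) + b (t.1.2 + ((gF (t.1.1 + t.1.2) - t.2.2 : ℕ) : ZMod q))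
    else a (t.1.1 - (t.2.2 : ZMod q)) + b (t.1.2 - ((gB (t.1.1 + t.1.2) - t.2.2 : ℕ) : ZMod q))
  set C : Finset (Fin 2 → ℝ) := (MP ×ˢ ((Finset.univ : Finset Bool) ×ˢ Finset.range (L + 1))).image f with hCdef
  have hcardC : C.card ≤ 4 * (L + 1) * q := by
    calc C.card ≤ (MP ×ˢ ((Finset.univ : Finset Bool) ×ˢ Finset.range (L + 1))).card := Finset.card_image_le
      _ = MP.card * (2 * (L + 1)) := by
          rw [Finset.card_product, Finset.card_product, Finset.card_univ, Fintype.card_bool, Finset.card_range]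
      _ ≤ 2 * q * (2 * (L + 1)) := Nat.mul_le_mul_right _ hcardMP
      _ = 4 * (L + 1) * q := by ring
  -- every hull vertex of the union is a candidate
  have hcover : (convexHull ℝ (unionPts a b (Z : Set (ZMod q)) s)).extremePoints ℝ ⊆ (C : Set (Fin 2 → ℝ)) := by
    intro p hp
    obtain ⟨mα, mβ, hv, hchain⟩ := exists_modePair_chain_of_mem_extremePoints a b ha hb Z s hp
    have hmp : (mα, mβ) ∈ MP := Finset.mem_filter.2 ⟨Finset.mem_univ _, hv⟩
    rw [Finset.mem_coe, hCdef, Finset.mem_image]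
    rcases hchain with ⟨i, j, hpij, hZij, hmin⟩ | ⟨i, j, hpij, hZij, hmin⟩
    · have hg : gF (mα + mβ) = i + j := by
        rw [Nat.find_eq_iff]
        exact ⟨hZij, fun n hn => hmin n hn⟩
      have hiL : i < L + 1 := by have := gF_le (mα + mβ); omega
      refine ⟨((mα, mβ), (true, i)), Finset.mem_product.2 ⟨hmp, Finset.mem_product.2
        ⟨Finset.mem_univ _, Finset.mem_range.2 hiL⟩⟩, ?_⟩
      simp only [f, if_true, hg, Nat.add_sub_cancel_left]
      exact hpij.symm
    · have hg : gB (mα + mβ) = i + j := by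
        rw [Nat.find_eq_iff]
        exact ⟨hZij, fun n hn => hmin n hn⟩
      have hiL : i < L + 1 := by have := gB_le (mα + mβ); omega
      refine ⟨((mα, mβ), (false, i)), Finset.mem_product.2 ⟨hmp, Finset.mem_product.2
        ⟨Finset.mem_univ _, Finset.mem_range.2 hiL⟩⟩, ?_⟩
      simp only [f, hg, Nat.add_sub_cancel_left]
      exact hpij.symm
  unfold unionVert
  calc ((convexHull ℝ (unionPts a b (Z : Set (ZMod q)) s)).extremePoints ℝ).ncard
      ≤ (C : Set (Fin 2 → ℝ)).ncard := Set.ncard_le_ncard hcover (Finset.finite_toSet C)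
    _ = C.card := Set.ncard_coe_finset C
    _ ≤ 4 * (L + 1) * q := hcardC

/-- **The union totals law in the dense-positions regime**: `unionTotal a b Z ≤ 4(L + 1)·q²` for both curves convexly ordered
and injective and every position set meeting all windows of `L + 1` consecutive positions. [folklore] -/
theorem unionTotal_le_of_dense (ha : ConvexlyOrdered a) (hb : ConvexlyOrdered b) (hai : Function.Injective a)
    (hbi : Function.Injective b) (Z : Finset (ZMod q)) {L : ℕ}
    (hZ : ∀ z : ZMod q, ∃ n : ℕ, n ≤ L ∧ z + (n : ZMod q) ∈ Z) :
    unionTotal a b (Z : Set (ZMod q)) ≤ 4 * (L + 1) * q ^ 2 := by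
  unfold unionTotal
  calc ∑ s, unionVert a b (Z : Set (ZMod q)) s ≤ ∑ _s : ZMod q, 4 * (L + 1) * q :=
        Finset.sum_le_sum fun s _ => unionVert_le_of_dense a b ha hb hai hbi Z hZ s
    _ = 4 * (L + 1) * q ^ 2 := by rw [Finset.sum_const, Finset.card_univ, ZMod.card, smul_eq_mul]; ring

end ChainCount

end TotalsLaw

end Summit.ValiantsHypothesis.ValiantsHypothesis.Theorems.NewtonUnitEquationsDissociatedUniform
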